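import Summits.Ventures.CertifiedManyBodySolver.Observables.StiffnessVirtualStationBoxes
import HarnessLib

/-!
# Ventures/CertifiedManyBodySolver — Observables/StiffnessVirtualStationSecantCaps.lean

HONEST FRAMING: one-sided certified CEILINGS on the uniform flux stiffness (t–t′ f-sum class) — the «VIRTUAL STATION» leaf and box of the companions
`Observables/StiffnessVirtualStation.lean` / `Observables/StiffnessVirtualStationBoxes.lean` (hubbard-fast-reuse-2 g9) with the target CAP sharpened by
CONCAVITY of `U ↦ e(t, t′, U, n)` (secant extrapolation through one certified cap and one OUTER certified floor) instead of plain monotonicity in `U`;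
every leaf is CONDITIONAL on the rows it names; a ceiling never speaks to the presence of order; not a `T_c` estimate, not a superconductivity verdict;
no number of record. Zero compute, no definition, no claim node, no `sorry`.

Cell `pub/hubbard-fast` (D-0154 (1)(A) «CERTIFICATE REUSE along parameter paths»), seat `hubbard-fast-reuse-2` g10 (`prover-hubbard-fast-reuse-2-g10-0`), path family
«APEX TRANSPORT», line «SECANT CAPS».

THE POINT. The virtual station `X(U) = (U₁·hi − U·lo₁)/(U − U₁)` reads a CAP `e(1, t′, U, n) ≤ hi` at the target. g9 took `hi` from the next certified coupling
`U₂ ≥ U` by monotonicity (`energyDensityTT'_mono_U`), so `hi` jumps by the full station gap just above every certified cap. But `U ↦ e(t, t′, U, n)` is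
CONCAVE (`concaveOn_energyDensityTT'_U`): the chord through a certified CAP `R₂` at `U₂` and a certified FLOOR outside the target,
EXTRAPOLATED past the cap point, lies above `e` —

  LEFT of the cap point (`U ≤ U₂ < U₃`, floor `L₃` at `U₃`):   `e(U) ≤ R₂ + (R₂ − L₃)(U₂ − U)/(U₃ − U₂)`   (`energyDensityTT'_chord_le`),
  RIGHT of the cap point (`U₁ < U₂ ≤ U`, floor `L₁` at `U₁`):  `e(U) ≤ R₂ + (R₂ − L₁)(U − U₂)/(U₂ − U₁)`   (`energyDensityTT'_le_extrapolate`)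

(the `t′ = 0` closed forms are hubbard-obs's `capU_secant_left_le` / `capU_secant_right_le` of `Observables/PhaseSeparationExclusionUSegments`; §1 restates
them at every `(t, t′)` from the Literature lemmas so that this file does not import the phase-separation certificates). Both caps are AFFINE in `U`, so the
cleared word inequality of the companion's box theorems stays BILINEAR in `(U, t′)` and four corners still word a box (§2, cap `h₀ + h₁·U` on the box; §3 the
`n = 1` forms, where a `t′ = 0` cap at the target's OWN coupling is a cap at every `t′` by evenness + concavity in `t′`,
`energyDensityTT'_halfFilling_cap_of_tPrime_zero_cap_above` with `U₂ = U`).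

* §1 `energyDensityTT'_secantCap_left` / `…_right` (any `t, t′`, `0 ≤ n < 2`); `energyDensityTT'_halfFilling_cap_of_secant_left` / `…_right` (`n = 1`, every `t′`);
  `halfFilling_affineCap_on_Icc_of_secant_left` / `…_right` / `…_of_cap_above` (an affine `h₀ + h₁·U` dominating the secant — or a plain cap above the interval — at the two ends of
  `[U_a, U_b]` caps the whole interval);
* §2 `ObsStiffnessSeqCeilingAt_on_box_of_targetUChord_fermiSeaRow_left_affineCap` / `…_right_affineCap` (any density, any `t′₁`, cap `h₀ + h₁·U` on the box);
* §3 `ObsStiffnessSeqCeilingAt_on_box_halfFilling_targetUChord_left_affineCap` / `…_right_affineCap` (`n = 1`, source at a `t′ = 0` station, affine `t′ = 0` cap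
  on `[U_a, U_b]`, either sign of `t′`, ALL SIDES).

NOT said: nothing here beats an SDP kinetic node AT its own coupling; the secant needs a certified floor OUTSIDE the target on the far side of the cap point
(above the last certified floor of a density the left form is void); `λ ≠ 0` words are not of this form; no `T > 0`.

References: T. Koma, H. Tasaki, J. Stat. Phys. 76 (1994) 745, §1 [KomaTasaki1994]; D. J. Scalapino, S. R. White, S.-C. Zhang, PRB 47 (1993) 7995, §II
[ScalapinoWhiteZhang1993]; E. H. Lieb, M. Loss, Duke Math. J. 71 (1993) 337, §8 Theorem 8.2 [LiebLoss1993]; D. Ruelle, Statistical Mechanics: Rigorous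
Results (1969), §3.3 [Ruelle1969]; E. H. Lieb, F. Y. Wu, Physica A 321 (2003) 1, §1 eq. (3) [LiebWuPhysicaA2003]; R. B. Griffiths, J. Math. Phys. 7
(1966) 1215, §II [Griffiths1966].
-/

noncomputable section

namespace Summit.Ventures.CertifiedManyBodySolver.Observables

open Literature.MathematicalPhysics.QuantumLattice
open Literature.MathematicalPhysics.QuantumLattice.ThermodynamicLimit
open Literature.MathematicalPhysics.QuantumFieldTheory
open Literature.Probability.LatticeModels
open Matrix Finset Filter Topology HubbardWave0
open scoped Matrix BigOperators ComplexOrder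

/-! ## §1 Secant caps: concavity in `U` through a certified cap and an outer certified floor -/

section Secant

/-- **Secant cap, extrapolated LEFT of the cap point** (any `t, t′`, `0 ≤ n < 2`): `0 ≤ U ≤ U₂ < U₃`, a cap `e(t,t′,U₂,n) ≤ R₂` and a floor `L₃ ≤ e(t,t′,U₃,n)` give
`e(t,t′,U,n) ≤ R₂ + (R₂ − L₃)(U₂ − U)/(U₃ − U₂)` — `U₂` is interior to `[U, U₃]`, so `e(U₂)` lies above the chord of `e(U)` and `e(U₃)` (`energyDensityTT'_chord_le`).
[cite: Ruelle1969, §3.3] -/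
theorem energyDensityTT'_secantCap_left (t t' : ℝ) {n : ℝ} (hn0 : 0 ≤ n) (hn2 : n < 2) {U U₂ U₃ R₂ L₃ : ℝ} (hU : 0 ≤ U)
    (hU2 : U ≤ U₂) (h23 : U₂ < U₃) (hR₂ : energyDensityTT' t t' U₂ n ≤ R₂) (hL₃ : L₃ ≤ energyDensityTT' t t' U₃ n) :
    energyDensityTT' t t' U n ≤ R₂ + (R₂ - L₃) * (U₂ - U) / (U₃ - U₂) := by
  rcases hU2.eq_or_lt with h | h
  · rw [h, sub_self, mul_zero, zero_div, add_zero]; exact hR₂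
  · have hc := energyDensityTT'_chord_le t t' hn0 hn2 (U₁ := U) (U := U₂) (U₂ := U₃) hU h h23 le_rfl hL₃
    have hd : 0 < U₃ - U := by linarith
    have hd' : 0 < U₃ - U₂ := by linarith
    rw [div_le_iff₀ hd] at hc
    have key : energyDensityTT' t t' U n * (U₃ - U₂) ≤ R₂ * (U₃ - U₂) + (R₂ - L₃) * (U₂ - U) := by
      nlinarith [hc, hR₂]
    have e : R₂ + (R₂ - L₃) * (U₂ - U) / (U₃ - U₂) = (R₂ * (U₃ - U₂) + (R₂ - L₃) * (U₂ - U)) / (U₃ - U₂) := by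
      field_simp
    rw [e, le_div_iff₀ hd']
    exact key

/-- **Secant cap, extrapolated RIGHT of the cap point** (any `t, t′`, `0 ≤ n < 2`): `0 ≤ U₁ < U₂ ≤ U`, a floor `L₁ ≤ e(t,t′,U₁,n)` and a cap `e(t,t′,U₂,n) ≤ R₂` give
`e(t,t′,U,n) ≤ R₂ + (R₂ − L₁)(U − U₂)/(U₂ − U₁)` (`energyDensityTT'_le_extrapolate` plus the endpoint `U = U₂`). [cite: Ruelle1969, §3.3] -/
theorem energyDensityTT'_secantCap_right (t t' : ℝ) {n : ℝ} (hn0 : 0 ≤ n) (hn2 : n < 2) {U₁ U₂ U L₁ R₂ : ℝ} (hU₁ : 0 ≤ U₁)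
    (h12 : U₁ < U₂) (h2U : U₂ ≤ U) (hL₁ : L₁ ≤ energyDensityTT' t t' U₁ n) (hR₂ : energyDensityTT' t t' U₂ n ≤ R₂) :
    energyDensityTT' t t' U n ≤ R₂ + (R₂ - L₁) * (U - U₂) / (U₂ - U₁) := by
  rcases h2U.eq_or_lt with h | h
  · rw [← h, sub_self, mul_zero, zero_div, add_zero]; exact hR₂
  · exact energyDensityTT'_le_extrapolate t t' hn0 hn2 hU₁ h12 h hL₁ hR₂

/-- **Half filling: a LEFT secant cap of the `t′ = 0` column at the target's own coupling is a cap at every `t′`** (`e(1, ·, U, 1)` is even and concave in `t′`,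
hence maximal at `t′ = 0` — `energyDensityTT'_halfFilling_cap_of_tPrime_zero_cap_above` with `U₂ = U`). [cite: LiebWuPhysicaA2003, §1 eq. (3)] [cite: Ruelle1969, §3.3] -/
theorem energyDensityTT'_halfFilling_cap_of_secant_left (t : ℝ) {U U₂ U₃ R₂ L₃ : ℝ} (hU : 0 ≤ U) (hU2 : U ≤ U₂) (h23 : U₂ < U₃)
    (hR₂ : energyDensityTT' 1 0 U₂ 1 ≤ R₂) (hL₃ : L₃ ≤ energyDensityTT' 1 0 U₃ 1) :
    energyDensityTT' 1 t U 1 ≤ R₂ + (R₂ - L₃) * (U₂ - U) / (U₃ - U₂) :=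
  energyDensityTT'_halfFilling_cap_of_tPrime_zero_cap_above t hU le_rfl
    (energyDensityTT'_secantCap_left 1 0 (n := 1) (by norm_num) (by norm_num) hU hU2 h23 hR₂ hL₃)

/-- **Half filling: a RIGHT secant cap of the `t′ = 0` column at the target's own coupling is a cap at every `t′`.** [cite: LiebWuPhysicaA2003, §1 eq. (3)] [cite: Ruelle1969, §3.3] -/
theorem energyDensityTT'_halfFilling_cap_of_secant_right (t : ℝ) {U₁ U₂ U L₁ R₂ : ℝ} (hU₁ : 0 ≤ U₁) (h12 : U₁ < U₂) (h2U : U₂ ≤ U)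
    (hL₁ : L₁ ≤ energyDensityTT' 1 0 U₁ 1) (hR₂ : energyDensityTT' 1 0 U₂ 1 ≤ R₂) :
    energyDensityTT' 1 t U 1 ≤ R₂ + (R₂ - L₁) * (U - U₂) / (U₂ - U₁) :=
  energyDensityTT'_halfFilling_cap_of_tPrime_zero_cap_above t (hU₁.trans (h12.le.trans h2U)) le_rfl
    (energyDensityTT'_secantCap_right 1 0 (n := 1) (by norm_num) (by norm_num) hU₁ h12 h2U hL₁ hR₂)

/-- **Affine cap on an interval from a LEFT secant** (`n = 1`, `t′ = 0`): if `0 ≤ U_a < U_b ≤ U₂ < U₃` and an affine function `h₀ + h₁·U` dominates the secant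
`R₂ + (R₂ − L₃)(U₂ − U)/(U₃ − U₂)` at BOTH ends `U_a`, `U_b` (two decidable checks; the secant is affine), then `e(1, 0, U, 1) ≤ h₀ + h₁·U` on `[U_a, U_b]`.
[cite: Ruelle1969, §3.3] -/
theorem halfFilling_affineCap_on_Icc_of_secant_left {Ua Ub U₂ U₃ R₂ L₃ h₀ h₁ : ℝ} (hUa : 0 ≤ Ua) (hab : Ua < Ub) (hb2 : Ub ≤ U₂) (h23 : U₂ < U₃)
    (hR₂ : energyDensityTT' 1 0 U₂ 1 ≤ R₂) (hL₃ : L₃ ≤ energyDensityTT' 1 0 U₃ 1)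
    (hA : R₂ + (R₂ - L₃) * (U₂ - Ua) / (U₃ - U₂) ≤ h₀ + h₁ * Ua) (hB : R₂ + (R₂ - L₃) * (U₂ - Ub) / (U₃ - U₂) ≤ h₀ + h₁ * Ub) :
    ∀ U ∈ Set.Icc Ua Ub, energyDensityTT' 1 0 U 1 ≤ h₀ + h₁ * U := by
  intro U hU
  have hsec := energyDensityTT'_secantCap_left 1 0 (n := 1) (by norm_num) (by norm_num) (hUa.trans hU.1) (hU.2.trans hb2) h23 hR₂ hL₃
  have hpos : 0 < Ub - Ua := sub_pos.2 hab
  -- the gap `h₀ + h₁U − secant(U)` is affine in `U`: interpolate it from the two ends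
  have key : (Ub - Ua) * (h₀ + h₁ * U - (R₂ + (R₂ - L₃) * (U₂ - U) / (U₃ - U₂))) =
      (Ub - U) * (h₀ + h₁ * Ua - (R₂ + (R₂ - L₃) * (U₂ - Ua) / (U₃ - U₂))) +
      (U - Ua) * (h₀ + h₁ * Ub - (R₂ + (R₂ - L₃) * (U₂ - Ub) / (U₃ - U₂))) := by ring
  have hnn : 0 ≤ (Ub - Ua) * (h₀ + h₁ * U - (R₂ + (R₂ - L₃) * (U₂ - U) / (U₃ - U₂))) := by
    rw [key]
    exact add_nonneg (mul_nonneg (sub_nonneg.2 hU.2) (sub_nonneg.2 hA)) (mul_nonneg (sub_nonneg.2 hU.1) (sub_nonneg.2 hB))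
  have hm := (mul_nonneg_iff_of_pos_left hpos).1 hnn
  linarith

/-- **Affine cap on an interval from a RIGHT secant** (`n = 1`, `t′ = 0`): `0 ≤ U₁ < U₂ ≤ U_a < U_b`, floor `L₁` at `U₁`, cap `R₂` at `U₂`, and `h₀ + h₁·U` dominating
`R₂ + (R₂ − L₁)(U − U₂)/(U₂ − U₁)` at `U_a` and `U_b` ⇒ `e(1, 0, U, 1) ≤ h₀ + h₁·U` on `[U_a, U_b]`. [cite: Ruelle1969, §3.3] -/
theorem halfFilling_affineCap_on_Icc_of_secant_right {U₁ U₂ Ua Ub L₁ R₂ h₀ h₁ : ℝ} (hU₁ : 0 ≤ U₁) (h12 : U₁ < U₂) (h2a : U₂ ≤ Ua) (hab : Ua < Ub)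
    (hL₁ : L₁ ≤ energyDensityTT' 1 0 U₁ 1) (hR₂ : energyDensityTT' 1 0 U₂ 1 ≤ R₂)
    (hA : R₂ + (R₂ - L₁) * (Ua - U₂) / (U₂ - U₁) ≤ h₀ + h₁ * Ua) (hB : R₂ + (R₂ - L₁) * (Ub - U₂) / (U₂ - U₁) ≤ h₀ + h₁ * Ub) :
    ∀ U ∈ Set.Icc Ua Ub, energyDensityTT' 1 0 U 1 ≤ h₀ + h₁ * U := by
  intro U hU
  have hsec := energyDensityTT'_secantCap_right 1 0 (n := 1) (by norm_num) (by norm_num) hU₁ h12 (h2a.trans hU.1) hL₁ hR₂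
  have hpos : 0 < Ub - Ua := sub_pos.2 hab
  have key : (Ub - Ua) * (h₀ + h₁ * U - (R₂ + (R₂ - L₁) * (U - U₂) / (U₂ - U₁))) =
      (Ub - U) * (h₀ + h₁ * Ua - (R₂ + (R₂ - L₁) * (Ua - U₂) / (U₂ - U₁))) +
      (U - Ua) * (h₀ + h₁ * Ub - (R₂ + (R₂ - L₁) * (Ub - U₂) / (U₂ - U₁))) := by ring
  have hnn : 0 ≤ (Ub - Ua) * (h₀ + h₁ * U - (R₂ + (R₂ - L₁) * (U - U₂) / (U₂ - U₁))) := by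
    rw [key]
    exact add_nonneg (mul_nonneg (sub_nonneg.2 hU.2) (sub_nonneg.2 hA)) (mul_nonneg (sub_nonneg.2 hU.1) (sub_nonneg.2 hB))
  have hm := (mul_nonneg_iff_of_pos_left hpos).1 hnn
  linarith

/-- **Affine cap on an interval from a cap ABOVE it** (`n = 1`, `t′ = 0`; the g9 monotone transport in affine dress): `0 ≤ U_a < U_b ≤ U₂`, cap `R₂` at `U₂`, and
`h₀ + h₁·U ≥ R₂` at `U_a` and `U_b` ⇒ `e(1, 0, U, 1) ≤ h₀ + h₁·U` on `[U_a, U_b]` (`energyDensityTT'_mono_U`). [cite: Griffiths1966, §II] -/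
theorem halfFilling_affineCap_on_Icc_of_cap_above {Ua Ub U₂ R₂ h₀ h₁ : ℝ} (hUa : 0 ≤ Ua) (hab : Ua < Ub) (hb2 : Ub ≤ U₂)
    (hR₂ : energyDensityTT' 1 0 U₂ 1 ≤ R₂) (hA : R₂ ≤ h₀ + h₁ * Ua) (hB : R₂ ≤ h₀ + h₁ * Ub) :
    ∀ U ∈ Set.Icc Ua Ub, energyDensityTT' 1 0 U 1 ≤ h₀ + h₁ * U := by
  intro U hU
  have hmono := energyDensityTT'_mono_U 1 0 (n := 1) (by norm_num) (by norm_num) (hUa.trans hU.1) (hU.2.trans hb2)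
  have hpos : 0 < Ub - Ua := sub_pos.2 hab
  have key : (Ub - Ua) * (h₀ + h₁ * U - R₂) = (Ub - U) * (h₀ + h₁ * Ua - R₂) + (U - Ua) * (h₀ + h₁ * Ub - R₂) := by ring
  have hnn : 0 ≤ (Ub - Ua) * (h₀ + h₁ * U - R₂) := by
    rw [key]
    exact add_nonneg (mul_nonneg (sub_nonneg.2 hU.2) (sub_nonneg.2 hA)) (mul_nonneg (sub_nonneg.2 hU.1) (sub_nonneg.2 hB))
  have hm := (mul_nonneg_iff_of_pos_left hpos).1 hnn
  linarith

end Secant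

/-! ## §2 THE BOX THEOREMS with an AFFINE cap `h₀ + h₁·U` on the box (any density): the cleared word inequality is still bilinear — four corners word the box -/

section Box

variable {n t₁ U₁ : ℝ}

/-- **BOX WORD, Fermi-sea row LEFT, affine cap** (`κ₂ < 2t′ ≤ κ` on the box; the `t′ ≤ 0` side of a `t′₁ = 0` source). Floor `lo₁ ≤ e(1, t′₁, U₁, n)`, `0 ≤ U₁ < U_a < U_b`,
`t_a < t_b`; a cap AFFINE IN `U` valid at every point of the box (`e(1, t′, U, n) ≤ h₀ + h₁·U`); a free-gas floor `ℓ₂ ≤ e(1, κ₂, 0, n)` with `κ₂ < 2t_a`; the bracket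
orientation `2t′d ≤ K` (`K = U·t′₁ − U₁·t′`, `d = U − U₁`) at the four corners; and the cleared word inequality
`P(U, t′) = 4c(K − κ₂d) + (2t′ − κ₂)(U·lo₁ − U₁·(h₀ + h₁U)) + ℓ₂(K − 2t′d) ≥ 0` at the FOUR CORNERS. Then `ObsStiffnessSeqCeilingAt t′ U n c` at every point of the box
(`P` is affine in `U` at fixed `t′` and affine in `t′` at fixed `U`; `box_corner_interp`; the companion's `…_left_cleared` at the point with `hi = h₀ + h₁U`).
[cite: KomaTasaki1994, §1] [cite: ScalapinoWhiteZhang1993, §II] [cite: LiebLoss1993, §8, Theorem 8.2] -/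
theorem ObsStiffnessSeqCeilingAt_on_box_of_targetUChord_fermiSeaRow_left_affineCap (hU₁0 : 0 ≤ U₁) (hn0 : 0 ≤ n) (hn2 : n < 2)
    {lo₁ : ℝ} (hfloor : lo₁ ≤ energyDensityTT' 1 t₁ U₁ n) {κ₂ ℓ₂ : ℝ} (h₂ : ℓ₂ ≤ energyDensityTT' 1 κ₂ 0 n)
    {Ua Ub ta tb h₀ h₁ : ℝ} (hUa : U₁ < Ua) (hab : Ua < Ub) (htab : ta < tb) (hτ : κ₂ < 2 * ta)
    (hcapbox : ∀ U ∈ Set.Icc Ua Ub, ∀ t ∈ Set.Icc ta tb, energyDensityTT' 1 t U n ≤ h₀ + h₁ * U)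
    (hbr₁ : 2 * ta * (Ua - U₁) ≤ Ua * t₁ - U₁ * ta) (hbr₂ : 2 * tb * (Ua - U₁) ≤ Ua * t₁ - U₁ * tb)
    (hbr₃ : 2 * ta * (Ub - U₁) ≤ Ub * t₁ - U₁ * ta) (hbr₄ : 2 * tb * (Ub - U₁) ≤ Ub * t₁ - U₁ * tb) (c : ℚ)
    (hP₁ : 0 ≤ 4 * ((c : ℚ) : ℝ) * ((Ua * t₁ - U₁ * ta) - κ₂ * (Ua - U₁)) + (2 * ta - κ₂) * (Ua * lo₁ - U₁ * (h₀ + h₁ * Ua)) + ℓ₂ * ((Ua * t₁ - U₁ * ta) - 2 * ta * (Ua - U₁)))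
    (hP₂ : 0 ≤ 4 * ((c : ℚ) : ℝ) * ((Ua * t₁ - U₁ * tb) - κ₂ * (Ua - U₁)) + (2 * tb - κ₂) * (Ua * lo₁ - U₁ * (h₀ + h₁ * Ua)) + ℓ₂ * ((Ua * t₁ - U₁ * tb) - 2 * tb * (Ua - U₁)))
    (hP₃ : 0 ≤ 4 * ((c : ℚ) : ℝ) * ((Ub * t₁ - U₁ * ta) - κ₂ * (Ub - U₁)) + (2 * ta - κ₂) * (Ub * lo₁ - U₁ * (h₀ + h₁ * Ub)) + ℓ₂ * ((Ub * t₁ - U₁ * ta) - 2 * ta * (Ub - U₁)))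
    (hP₄ : 0 ≤ 4 * ((c : ℚ) : ℝ) * ((Ub * t₁ - U₁ * tb) - κ₂ * (Ub - U₁)) + (2 * tb - κ₂) * (Ub * lo₁ - U₁ * (h₀ + h₁ * Ub)) + ℓ₂ * ((Ub * t₁ - U₁ * tb) - 2 * tb * (Ub - U₁))) :
    ∀ U ∈ Set.Icc Ua Ub, ∀ t ∈ Set.Icc ta tb, ObsStiffnessSeqCeilingAt t U n c := by
  intro U hU t ht
  have hUlt : U₁ < U := hUa.trans_le hU.1
  have hpos : 0 < (Ub - Ua) * (tb - ta) := mul_pos (sub_pos.2 hab) (sub_pos.2 htab)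
  have hbr : 2 * t * (U - U₁) ≤ U * t₁ - U₁ * t := by
    have h := box_corner_interp hU ht (sub_nonneg.2 hbr₁) (sub_nonneg.2 hbr₂) (sub_nonneg.2 hbr₃) (sub_nonneg.2 hbr₄)
    have key : (Ub - Ua) * (tb - ta) * ((U * t₁ - U₁ * t) - 2 * t * (U - U₁)) =
        (Ub - U) * (tb - t) * ((Ua * t₁ - U₁ * ta) - 2 * ta * (Ua - U₁)) + (Ub - U) * (t - ta) * ((Ua * t₁ - U₁ * tb) - 2 * tb * (Ua - U₁)) +
        (U - Ua) * (tb - t) * ((Ub * t₁ - U₁ * ta) - 2 * ta * (Ub - U₁)) + (U - Ua) * (t - ta) * ((Ub * t₁ - U₁ * tb) - 2 * tb * (Ub - U₁)) := by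
      ring
    have hnn : 0 ≤ (Ub - Ua) * (tb - ta) * ((U * t₁ - U₁ * t) - 2 * t * (U - U₁)) := by rw [key]; exact h
    have := (mul_nonneg_iff_of_pos_left hpos).1 hnn
    linarith
  have hτ' : κ₂ < 2 * t := by linarith [ht.1]
  refine ObsStiffnessSeqCeilingAt_of_targetUChord_fermiSeaRow_left_cleared hU₁0 hUlt hn0 hn2 hfloor (hcapbox U hU t ht) h₂ hbr hτ' c ?_
  have h := box_corner_interp hU ht hP₁ hP₂ hP₃ hP₄
  have key : (Ub - Ua) * (tb - ta) * (4 * ((c : ℚ) : ℝ) * ((U * t₁ - U₁ * t) - κ₂ * (U - U₁)) + (2 * t - κ₂) * (U * lo₁ - U₁ * (h₀ + h₁ * U)) +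
      ℓ₂ * ((U * t₁ - U₁ * t) - 2 * t * (U - U₁))) =
      (Ub - U) * (tb - t) * (4 * ((c : ℚ) : ℝ) * ((Ua * t₁ - U₁ * ta) - κ₂ * (Ua - U₁)) + (2 * ta - κ₂) * (Ua * lo₁ - U₁ * (h₀ + h₁ * Ua)) + ℓ₂ * ((Ua * t₁ - U₁ * ta) - 2 * ta * (Ua - U₁))) +
      (Ub - U) * (t - ta) * (4 * ((c : ℚ) : ℝ) * ((Ua * t₁ - U₁ * tb) - κ₂ * (Ua - U₁)) + (2 * tb - κ₂) * (Ua * lo₁ - U₁ * (h₀ + h₁ * Ua)) + ℓ₂ * ((Ua * t₁ - U₁ * tb) - 2 * tb * (Ua - U₁))) +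
      (U - Ua) * (tb - t) * (4 * ((c : ℚ) : ℝ) * ((Ub * t₁ - U₁ * ta) - κ₂ * (Ub - U₁)) + (2 * ta - κ₂) * (Ub * lo₁ - U₁ * (h₀ + h₁ * Ub)) + ℓ₂ * ((Ub * t₁ - U₁ * ta) - 2 * ta * (Ub - U₁))) +
      (U - Ua) * (t - ta) * (4 * ((c : ℚ) : ℝ) * ((Ub * t₁ - U₁ * tb) - κ₂ * (Ub - U₁)) + (2 * tb - κ₂) * (Ub * lo₁ - U₁ * (h₀ + h₁ * Ub)) + ℓ₂ * ((Ub * t₁ - U₁ * tb) - 2 * tb * (Ub - U₁))) := by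
    ring
  have hnn : 0 ≤ (Ub - Ua) * (tb - ta) * (4 * ((c : ℚ) : ℝ) * ((U * t₁ - U₁ * t) - κ₂ * (U - U₁)) + (2 * t - κ₂) * (U * lo₁ - U₁ * (h₀ + h₁ * U)) +
      ℓ₂ * ((U * t₁ - U₁ * t) - 2 * t * (U - U₁))) := by rw [key]; exact h
  exact (mul_nonneg_iff_of_pos_left hpos).1 hnn

/-- **BOX WORD, Fermi-sea row RIGHT, affine cap** (`κ ≤ 2t′ < κ₂` on the box; the `t′ ≥ 0` side of a `t′₁ = 0` source). Same data with `2t_b < κ₂`; corners: `K ≤ 2t′d` and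
`P′(U, t′) = 4c(κ₂d − K) + (κ₂ − 2t′)(U·lo₁ − U₁·(h₀ + h₁U)) + ℓ₂(2t′d − K) ≥ 0`. Then `ObsStiffnessSeqCeilingAt t′ U n c` on the whole box.
[cite: KomaTasaki1994, §1] [cite: ScalapinoWhiteZhang1993, §II] [cite: LiebLoss1993, §8, Theorem 8.2] -/
theorem ObsStiffnessSeqCeilingAt_on_box_of_targetUChord_fermiSeaRow_right_affineCap (hU₁0 : 0 ≤ U₁) (hn0 : 0 ≤ n) (hn2 : n < 2)
    {lo₁ : ℝ} (hfloor : lo₁ ≤ energyDensityTT' 1 t₁ U₁ n) {κ₂ ℓ₂ : ℝ} (h₂ : ℓ₂ ≤ energyDensityTT' 1 κ₂ 0 n)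
    {Ua Ub ta tb h₀ h₁ : ℝ} (hUa : U₁ < Ua) (hab : Ua < Ub) (htab : ta < tb) (hτ : 2 * tb < κ₂)
    (hcapbox : ∀ U ∈ Set.Icc Ua Ub, ∀ t ∈ Set.Icc ta tb, energyDensityTT' 1 t U n ≤ h₀ + h₁ * U)
    (hbr₁ : Ua * t₁ - U₁ * ta ≤ 2 * ta * (Ua - U₁)) (hbr₂ : Ua * t₁ - U₁ * tb ≤ 2 * tb * (Ua - U₁))
    (hbr₃ : Ub * t₁ - U₁ * ta ≤ 2 * ta * (Ub - U₁)) (hbr₄ : Ub * t₁ - U₁ * tb ≤ 2 * tb * (Ub - U₁)) (c : ℚ)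
    (hP₁ : 0 ≤ 4 * ((c : ℚ) : ℝ) * (κ₂ * (Ua - U₁) - (Ua * t₁ - U₁ * ta)) + (κ₂ - 2 * ta) * (Ua * lo₁ - U₁ * (h₀ + h₁ * Ua)) + ℓ₂ * (2 * ta * (Ua - U₁) - (Ua * t₁ - U₁ * ta)))
    (hP₂ : 0 ≤ 4 * ((c : ℚ) : ℝ) * (κ₂ * (Ua - U₁) - (Ua * t₁ - U₁ * tb)) + (κ₂ - 2 * tb) * (Ua * lo₁ - U₁ * (h₀ + h₁ * Ua)) + ℓ₂ * (2 * tb * (Ua - U₁) - (Ua * t₁ - U₁ * tb)))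
    (hP₃ : 0 ≤ 4 * ((c : ℚ) : ℝ) * (κ₂ * (Ub - U₁) - (Ub * t₁ - U₁ * ta)) + (κ₂ - 2 * ta) * (Ub * lo₁ - U₁ * (h₀ + h₁ * Ub)) + ℓ₂ * (2 * ta * (Ub - U₁) - (Ub * t₁ - U₁ * ta)))
    (hP₄ : 0 ≤ 4 * ((c : ℚ) : ℝ) * (κ₂ * (Ub - U₁) - (Ub * t₁ - U₁ * tb)) + (κ₂ - 2 * tb) * (Ub * lo₁ - U₁ * (h₀ + h₁ * Ub)) + ℓ₂ * (2 * tb * (Ub - U₁) - (Ub * t₁ - U₁ * tb))) :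
    ∀ U ∈ Set.Icc Ua Ub, ∀ t ∈ Set.Icc ta tb, ObsStiffnessSeqCeilingAt t U n c := by
  intro U hU t ht
  have hUlt : U₁ < U := hUa.trans_le hU.1
  have hpos : 0 < (Ub - Ua) * (tb - ta) := mul_pos (sub_pos.2 hab) (sub_pos.2 htab)
  have hbr : U * t₁ - U₁ * t ≤ 2 * t * (U - U₁) := by
    have h := box_corner_interp hU ht (sub_nonneg.2 hbr₁) (sub_nonneg.2 hbr₂) (sub_nonneg.2 hbr₃) (sub_nonneg.2 hbr₄)
    have key : (Ub - Ua) * (tb - ta) * (2 * t * (U - U₁) - (U * t₁ - U₁ * t)) =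
        (Ub - U) * (tb - t) * (2 * ta * (Ua - U₁) - (Ua * t₁ - U₁ * ta)) + (Ub - U) * (t - ta) * (2 * tb * (Ua - U₁) - (Ua * t₁ - U₁ * tb)) +
        (U - Ua) * (tb - t) * (2 * ta * (Ub - U₁) - (Ub * t₁ - U₁ * ta)) + (U - Ua) * (t - ta) * (2 * tb * (Ub - U₁) - (Ub * t₁ - U₁ * tb)) := by
      ring
    have hnn : 0 ≤ (Ub - Ua) * (tb - ta) * (2 * t * (U - U₁) - (U * t₁ - U₁ * t)) := by rw [key]; exact h
    have := (mul_nonneg_iff_of_pos_left hpos).1 hnn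
    linarith
  have hτ' : 2 * t < κ₂ := by linarith [ht.2]
  refine ObsStiffnessSeqCeilingAt_of_targetUChord_fermiSeaRow_right_cleared hU₁0 hUlt hn0 hn2 hfloor (hcapbox U hU t ht) h₂ hbr hτ' c ?_
  have h := box_corner_interp hU ht hP₁ hP₂ hP₃ hP₄
  have key : (Ub - Ua) * (tb - ta) * (4 * ((c : ℚ) : ℝ) * (κ₂ * (U - U₁) - (U * t₁ - U₁ * t)) + (κ₂ - 2 * t) * (U * lo₁ - U₁ * (h₀ + h₁ * U)) +
      ℓ₂ * (2 * t * (U - U₁) - (U * t₁ - U₁ * t))) =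
      (Ub - U) * (tb - t) * (4 * ((c : ℚ) : ℝ) * (κ₂ * (Ua - U₁) - (Ua * t₁ - U₁ * ta)) + (κ₂ - 2 * ta) * (Ua * lo₁ - U₁ * (h₀ + h₁ * Ua)) + ℓ₂ * (2 * ta * (Ua - U₁) - (Ua * t₁ - U₁ * ta))) +
      (Ub - U) * (t - ta) * (4 * ((c : ℚ) : ℝ) * (κ₂ * (Ua - U₁) - (Ua * t₁ - U₁ * tb)) + (κ₂ - 2 * tb) * (Ua * lo₁ - U₁ * (h₀ + h₁ * Ua)) + ℓ₂ * (2 * tb * (Ua - U₁) - (Ua * t₁ - U₁ * tb))) +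
      (U - Ua) * (tb - t) * (4 * ((c : ℚ) : ℝ) * (κ₂ * (Ub - U₁) - (Ub * t₁ - U₁ * ta)) + (κ₂ - 2 * ta) * (Ub * lo₁ - U₁ * (h₀ + h₁ * Ub)) + ℓ₂ * (2 * ta * (Ub - U₁) - (Ub * t₁ - U₁ * ta))) +
      (U - Ua) * (t - ta) * (4 * ((c : ℚ) : ℝ) * (κ₂ * (Ub - U₁) - (Ub * t₁ - U₁ * tb)) + (κ₂ - 2 * tb) * (Ub * lo₁ - U₁ * (h₀ + h₁ * Ub)) + ℓ₂ * (2 * tb * (Ub - U₁) - (Ub * t₁ - U₁ * tb))) := by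
    ring
  have hnn : 0 ≤ (Ub - Ua) * (tb - ta) * (4 * ((c : ℚ) : ℝ) * (κ₂ * (U - U₁) - (U * t₁ - U₁ * t)) + (κ₂ - 2 * t) * (U * lo₁ - U₁ * (h₀ + h₁ * U)) +
      ℓ₂ * (2 * t * (U - U₁) - (U * t₁ - U₁ * t))) := by rw [key]; exact h
  exact (mul_nonneg_iff_of_pos_left hpos).1 hnn

/-! ## §3 `n = 1`: the affine `t′ = 0` cap on the `U`-interval is a cap at every `t′` of the box -/

/-- **BOX WORD at HALF FILLING, `t′ ≤ 0` side, affine cap** (`n = 1`): an affine `t′ = 0` cap on the `U`-interval (`e(1, 0, U, 1) ≤ h₀ + h₁U` for `U ∈ [U_a, U_b]`, e.g. a secant of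
§1), the floor at a `t′ = 0` station `U₁ < U_a`, the Fermi-sea row at `κ₂ < 2t_a`, `t_b ≤ 0`; four corner checks of
`P(U, t′) = 4c(−U₁t′ − κ₂d) + (2t′ − κ₂)(U·lo₁ − U₁·(h₀ + h₁U)) − ℓ₂·t′·(2U − U₁) ≥ 0`. Then `ObsStiffnessSeqCeilingAt t′ U 1 c` on `[U_a, U_b] × [t_a, t_b]`.
[cite: KomaTasaki1994, §1] [cite: ScalapinoWhiteZhang1993, §II] [cite: LiebWuPhysicaA2003, §1 eq. (3)] -/
theorem ObsStiffnessSeqCeilingAt_on_box_halfFilling_targetUChord_left_affineCap {U₁ lo₁ : ℝ} (hU₁0 : 0 ≤ U₁)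
    (hfloor : lo₁ ≤ energyDensityTT' 1 0 U₁ 1) {κ₂ ℓ₂ : ℝ} (h₂ : ℓ₂ ≤ energyDensityTT' 1 κ₂ 0 1)
    {Ua Ub ta tb h₀ h₁ : ℝ} (hUa : U₁ < Ua) (hab : Ua < Ub) (htab : ta < tb) (htb : tb ≤ 0) (hτ : κ₂ < 2 * ta)
    (hcap0 : ∀ U ∈ Set.Icc Ua Ub, energyDensityTT' 1 0 U 1 ≤ h₀ + h₁ * U) (c : ℚ)
    (hP₁ : 0 ≤ 4 * ((c : ℚ) : ℝ) * (-(U₁ * ta) - κ₂ * (Ua - U₁)) + (2 * ta - κ₂) * (Ua * lo₁ - U₁ * (h₀ + h₁ * Ua)) - ℓ₂ * ta * (2 * Ua - U₁))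
    (hP₂ : 0 ≤ 4 * ((c : ℚ) : ℝ) * (-(U₁ * tb) - κ₂ * (Ua - U₁)) + (2 * tb - κ₂) * (Ua * lo₁ - U₁ * (h₀ + h₁ * Ua)) - ℓ₂ * tb * (2 * Ua - U₁))
    (hP₃ : 0 ≤ 4 * ((c : ℚ) : ℝ) * (-(U₁ * ta) - κ₂ * (Ub - U₁)) + (2 * ta - κ₂) * (Ub * lo₁ - U₁ * (h₀ + h₁ * Ub)) - ℓ₂ * ta * (2 * Ub - U₁))
    (hP₄ : 0 ≤ 4 * ((c : ℚ) : ℝ) * (-(U₁ * tb) - κ₂ * (Ub - U₁)) + (2 * tb - κ₂) * (Ub * lo₁ - U₁ * (h₀ + h₁ * Ub)) - ℓ₂ * tb * (2 * Ub - U₁)) :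
    ∀ U ∈ Set.Icc Ua Ub, ∀ t ∈ Set.Icc ta tb, ObsStiffnessSeqCeilingAt t U 1 c := by
  have hUa0 : 0 ≤ Ua := hU₁0.trans hUa.le
  refine ObsStiffnessSeqCeilingAt_on_box_of_targetUChord_fermiSeaRow_left_affineCap (t₁ := 0) (n := 1) hU₁0 (by norm_num) (by norm_num) hfloor h₂
    hUa hab htab hτ (h₀ := h₀) (h₁ := h₁) (fun U hU t _ => ?_) ?_ ?_ ?_ ?_ c ?_ ?_ ?_ ?_
  · exact energyDensityTT'_halfFilling_cap_of_tPrime_zero_cap_above t (hUa0.trans hU.1) le_rfl (hcap0 U hU)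
  · nlinarith [hUa.le, htab, htb]
  · nlinarith [hUa.le, htb]
  · nlinarith [hUa.le, hab.le, htab, htb]
  · nlinarith [hUa.le, hab.le, htb]
  · linarith [hP₁, show 4 * ((c : ℚ) : ℝ) * ((Ua * 0 - U₁ * ta) - κ₂ * (Ua - U₁)) + (2 * ta - κ₂) * (Ua * lo₁ - U₁ * (h₀ + h₁ * Ua)) +
      ℓ₂ * ((Ua * 0 - U₁ * ta) - 2 * ta * (Ua - U₁)) =
      4 * ((c : ℚ) : ℝ) * (-(U₁ * ta) - κ₂ * (Ua - U₁)) + (2 * ta - κ₂) * (Ua * lo₁ - U₁ * (h₀ + h₁ * Ua)) - ℓ₂ * ta * (2 * Ua - U₁) by ring]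
  · linarith [hP₂, show 4 * ((c : ℚ) : ℝ) * ((Ua * 0 - U₁ * tb) - κ₂ * (Ua - U₁)) + (2 * tb - κ₂) * (Ua * lo₁ - U₁ * (h₀ + h₁ * Ua)) +
      ℓ₂ * ((Ua * 0 - U₁ * tb) - 2 * tb * (Ua - U₁)) =
      4 * ((c : ℚ) : ℝ) * (-(U₁ * tb) - κ₂ * (Ua - U₁)) + (2 * tb - κ₂) * (Ua * lo₁ - U₁ * (h₀ + h₁ * Ua)) - ℓ₂ * tb * (2 * Ua - U₁) by ring]
  · linarith [hP₃, show 4 * ((c : ℚ) : ℝ) * ((Ub * 0 - U₁ * ta) - κ₂ * (Ub - U₁)) + (2 * ta - κ₂) * (Ub * lo₁ - U₁ * (h₀ + h₁ * Ub)) +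
      ℓ₂ * ((Ub * 0 - U₁ * ta) - 2 * ta * (Ub - U₁)) =
      4 * ((c : ℚ) : ℝ) * (-(U₁ * ta) - κ₂ * (Ub - U₁)) + (2 * ta - κ₂) * (Ub * lo₁ - U₁ * (h₀ + h₁ * Ub)) - ℓ₂ * ta * (2 * Ub - U₁) by ring]
  · linarith [hP₄, show 4 * ((c : ℚ) : ℝ) * ((Ub * 0 - U₁ * tb) - κ₂ * (Ub - U₁)) + (2 * tb - κ₂) * (Ub * lo₁ - U₁ * (h₀ + h₁ * Ub)) +
      ℓ₂ * ((Ub * 0 - U₁ * tb) - 2 * tb * (Ub - U₁)) =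
      4 * ((c : ℚ) : ℝ) * (-(U₁ * tb) - κ₂ * (Ub - U₁)) + (2 * tb - κ₂) * (Ub * lo₁ - U₁ * (h₀ + h₁ * Ub)) - ℓ₂ * tb * (2 * Ub - U₁) by ring]

/-- **BOX WORD at HALF FILLING, `t′ ≥ 0` side, affine cap** (`n = 1`, all sides, no parity condition): affine `t′ = 0` cap on `[U_a, U_b]`, floor at the station
`U₁ < U_a`, Fermi-sea row at `κ₂ > 2t_b` (e.g. a reflected row), `0 ≤ t_a`; four corner checks of
`P′(U, t′) = 4c(κ₂d + U₁t′) + (κ₂ − 2t′)(U·lo₁ − U₁·(h₀ + h₁U)) + ℓ₂·t′·(2U − U₁) ≥ 0`. Then `ObsStiffnessSeqCeilingAt t′ U 1 c` on `[U_a, U_b] × [t_a, t_b]`.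
[cite: KomaTasaki1994, §1] [cite: ScalapinoWhiteZhang1993, §II] [cite: LiebWuPhysicaA2003, §1 eq. (3)] -/
theorem ObsStiffnessSeqCeilingAt_on_box_halfFilling_targetUChord_right_affineCap {U₁ lo₁ : ℝ} (hU₁0 : 0 ≤ U₁)
    (hfloor : lo₁ ≤ energyDensityTT' 1 0 U₁ 1) {κ₂ ℓ₂ : ℝ} (h₂ : ℓ₂ ≤ energyDensityTT' 1 κ₂ 0 1)
    {Ua Ub ta tb h₀ h₁ : ℝ} (hUa : U₁ < Ua) (hab : Ua < Ub) (htab : ta < tb) (hta : 0 ≤ ta) (hτ : 2 * tb < κ₂)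
    (hcap0 : ∀ U ∈ Set.Icc Ua Ub, energyDensityTT' 1 0 U 1 ≤ h₀ + h₁ * U) (c : ℚ)
    (hP₁ : 0 ≤ 4 * ((c : ℚ) : ℝ) * (κ₂ * (Ua - U₁) + U₁ * ta) + (κ₂ - 2 * ta) * (Ua * lo₁ - U₁ * (h₀ + h₁ * Ua)) + ℓ₂ * ta * (2 * Ua - U₁))
    (hP₂ : 0 ≤ 4 * ((c : ℚ) : ℝ) * (κ₂ * (Ua - U₁) + U₁ * tb) + (κ₂ - 2 * tb) * (Ua * lo₁ - U₁ * (h₀ + h₁ * Ua)) + ℓ₂ * tb * (2 * Ua - U₁))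
    (hP₃ : 0 ≤ 4 * ((c : ℚ) : ℝ) * (κ₂ * (Ub - U₁) + U₁ * ta) + (κ₂ - 2 * ta) * (Ub * lo₁ - U₁ * (h₀ + h₁ * Ub)) + ℓ₂ * ta * (2 * Ub - U₁))
    (hP₄ : 0 ≤ 4 * ((c : ℚ) : ℝ) * (κ₂ * (Ub - U₁) + U₁ * tb) + (κ₂ - 2 * tb) * (Ub * lo₁ - U₁ * (h₀ + h₁ * Ub)) + ℓ₂ * tb * (2 * Ub - U₁)) :
    ∀ U ∈ Set.Icc Ua Ub, ∀ t ∈ Set.Icc ta tb, ObsStiffnessSeqCeilingAt t U 1 c := by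
  have hUa0 : 0 ≤ Ua := hU₁0.trans hUa.le
  refine ObsStiffnessSeqCeilingAt_on_box_of_targetUChord_fermiSeaRow_right_affineCap (t₁ := 0) (n := 1) hU₁0 (by norm_num) (by norm_num) hfloor h₂
    hUa hab htab hτ (h₀ := h₀) (h₁ := h₁) (fun U hU t _ => ?_) ?_ ?_ ?_ ?_ c ?_ ?_ ?_ ?_
  · exact energyDensityTT'_halfFilling_cap_of_tPrime_zero_cap_above t (hUa0.trans hU.1) le_rfl (hcap0 U hU)
  · nlinarith [hUa.le, hta]
  · nlinarith [hUa.le, htab, hta]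
  · nlinarith [hUa.le, hab.le, hta]
  · nlinarith [hUa.le, hab.le, htab, hta]
  · linarith [hP₁, show 4 * ((c : ℚ) : ℝ) * (κ₂ * (Ua - U₁) - (Ua * 0 - U₁ * ta)) + (κ₂ - 2 * ta) * (Ua * lo₁ - U₁ * (h₀ + h₁ * Ua)) +
      ℓ₂ * (2 * ta * (Ua - U₁) - (Ua * 0 - U₁ * ta)) =
      4 * ((c : ℚ) : ℝ) * (κ₂ * (Ua - U₁) + U₁ * ta) + (κ₂ - 2 * ta) * (Ua * lo₁ - U₁ * (h₀ + h₁ * Ua)) + ℓ₂ * ta * (2 * Ua - U₁) by ring]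
  · linarith [hP₂, show 4 * ((c : ℚ) : ℝ) * (κ₂ * (Ua - U₁) - (Ua * 0 - U₁ * tb)) + (κ₂ - 2 * tb) * (Ua * lo₁ - U₁ * (h₀ + h₁ * Ua)) +
      ℓ₂ * (2 * tb * (Ua - U₁) - (Ua * 0 - U₁ * tb)) =
      4 * ((c : ℚ) : ℝ) * (κ₂ * (Ua - U₁) + U₁ * tb) + (κ₂ - 2 * tb) * (Ua * lo₁ - U₁ * (h₀ + h₁ * Ua)) + ℓ₂ * tb * (2 * Ua - U₁) by ring]
  · linarith [hP₃, show 4 * ((c : ℚ) : ℝ) * (κ₂ * (Ub - U₁) - (Ub * 0 - U₁ * ta)) + (κ₂ - 2 * ta) * (Ub * lo₁ - U₁ * (h₀ + h₁ * Ub)) +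
      ℓ₂ * (2 * ta * (Ub - U₁) - (Ub * 0 - U₁ * ta)) =
      4 * ((c : ℚ) : ℝ) * (κ₂ * (Ub - U₁) + U₁ * ta) + (κ₂ - 2 * ta) * (Ub * lo₁ - U₁ * (h₀ + h₁ * Ub)) + ℓ₂ * ta * (2 * Ub - U₁) by ring]
  · linarith [hP₄, show 4 * ((c : ℚ) : ℝ) * (κ₂ * (Ub - U₁) - (Ub * 0 - U₁ * tb)) + (κ₂ - 2 * tb) * (Ub * lo₁ - U₁ * (h₀ + h₁ * Ub)) +
      ℓ₂ * (2 * tb * (Ub - U₁) - (Ub * 0 - U₁ * tb)) =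
      4 * ((c : ℚ) : ℝ) * (κ₂ * (Ub - U₁) + U₁ * tb) + (κ₂ - 2 * tb) * (Ub * lo₁ - U₁ * (h₀ + h₁ * Ub)) + ℓ₂ * tb * (2 * Ub - U₁) by ring]

end Box

end Summit.Ventures.CertifiedManyBodySolver.Observables

end
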